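import Summits.PneNP.PneNP.Theorems.SymmetryBudgetWindowCanoniserSemMain2

/-!
# Window canoniser, XXI: gate semantics of the main computation — part vectors, blocks and positions

Route `PneNP/SymmetryBudget`, dichotomy `WindowBarrier` (stmt-PneNP-2145) / `NoHiddenOrder` (stmt-PneNP-14781);
continuation of `…WindowCanoniserSemMain2.lean`.  The part vector `WCan.pvec u i = ev (pvecA u i)`; prefix
agreement `ppfx` and the comparisons `plexLT ↔ toLex (pvec u) < toLex (pvec u')`, `plexEQ ↔ pvec u = pvec u'`;
the START `WCan.pstart u` of the block of `u` (vertices with a smaller part vector) and its SIZE `WCan.pbc u`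
(vertices with the same part vector), through `pstGE`/`pbcGE`; the address decoding `pat p u i o ↔ WCan.patP`
(position `p` lies in the block of `u`, at component slot `i`, inner offset `o`), `off`, `blkI`.
-/

-- `Summit.PneNP.PneNP.…` duplicates `PneNP` BY DESIGN (single-problem summit, D-0017 layout).
set_option linter.dupNamespace false

noncomputable section

namespace Summit.PneNP.PneNP.Theorems

namespace WCan

open Finset Literature.Computability.Complexity Literature.Computability.Complexity.CGCanon
  Literature.Combinatorics.SimpleGraph
open scoped Classical

variable {K r n : ℕ}

section MathSide

variable [NeZero n] (L : Lab K n) (x : Fin (r + n) × Fin (r + n) → Bool)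

/-- The PART VECTOR of (the part of) `u`: the values of the atoms `pvecA u i`. -/
def pvec (u : Fin n) : Fin (NBp r n) → Bool := fun i => ev x (pvecA L u i)

/-- The START of the block of `u`: vertices of `W` whose part vector is lexicographically smaller. -/
def pstart (u : Fin n) : ℕ := ((finSt L.1 x).W.filter fun w => toLex (pvec (r := r) L x w) < toLex (pvec L x u)).card

/-- The SIZE of the block of `u`: vertices of `W` with the same part vector. -/
def pbc (u : Fin n) : ℕ := ((finSt L.1 x).W.filter fun w => pvec (r := r) L x w = pvec L x u).card

/-- ADDRESS DECODING: position `p` lies in the block of `u`, at component slot `i`, inner offset `o`, for the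
component size `s` recorded in the part vector of `u`. -/
def patP (p u i o : Fin n) : Prop :=
  ∃ s : Fin (n + 1), (o : ℕ) < s ∧ (i : ℕ) * s + o ≤ p ∧ ((i : ℕ) + 1) * s ≤ n ∧
    pstart (r := r) L x u = (p : ℕ) - ((i : ℕ) * s + o) ∧ pbitP (r := r) L x u (bpSize s) ∧ ((i : ℕ) + 1) * s ≤ pbc (r := r) L x u

end MathSide

variable [NeZero n] {L : Lab K n} {x : Fin (r + n) × Fin (r + n) → Bool} (hn : 2 ≤ n)
include hn

/-! ### Comparing part vectors -/

omit hn in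
/-- `ppfx u u' t`: the part vectors agree below `t`. -/
theorem ev_aPpfx (u u' : Fin n) (t : Fin (NBp r n + 1)) : ev x (aPpfx L u u' t) =
    decide (∀ i : Fin (NBp r n), (i : ℕ) < t → pvec L x u i = pvec L x u' i) := by
  apply Bool.eq_iff_iff.2
  show Vl K x _ = true ↔ _
  rw [Vl_eq, decide_eq_true_iff]
  show (GateFn.and (NBp r n)).2 (fun i => GateDAG.wire x (Vl K x) (Kind.argsM L .ppfx (prm (vec2 u u') (bp := t)) i)) = true ↔ _
  simp only [GateFn.and, decide_eq_true_iff, Kind.argsM, prm_vs, prm_bp, vec2_0, vec2_1]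
  refine forall_congr' fun i => ?_
  split_ifs with h
  · simp only [wire_w2, Vl_iffF, h, forall_true_left, pvec]
    constructor
    · intro h'; exact Bool.eq_iff_iff.2 h'
    · intro h'; rw [h']
  · simp [h]

omit hn in
/-- `plexLT u u'`: strict lexicographic comparison of part vectors. -/
theorem ev_aPlexLT (u u' : Fin n) : ev x (aPlexLT L u u') = decide (toLex (pvec L x u) < toLex (pvec (r := r) L x u')) := by
  apply Bool.eq_iff_iff.2
  show Vl K x _ = true ↔ _
  rw [Vl_eq, decide_eq_true_iff]
  show (GateFn.or (NBp r n)).2 (fun i => GateDAG.wire x (Vl K x) (Kind.argsM L .plexLT (prm (vec2 u u')) i)) = true ↔ _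
  simp only [GateFn.or, decide_eq_true_iff, Kind.argsM, prm_vs, vec2_0, vec2_1, wire_w1]
  rw [toLex_lt_iff]
  refine exists_congr fun i => ?_
  rw [Vl_n1and x _ (by simp)]
  simp only [List.mem_cons, List.not_mem_nil, or_false, forall_eq_or_imp, forall_eq, holds_pos, holds_neg, ev_aPpfx,
    Fin.val_castSucc, decide_eq_true_eq, pvec]
  constructor
  · rintro ⟨h1, h2, h3⟩; exact ⟨fun j hj => h1 j hj, h2, h3⟩
  · rintro ⟨h1, h2, h3⟩; exact ⟨fun j hj => h1 j hj, h2, h3⟩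

omit hn in
/-- `plexEQ u u'`: equal part vectors. -/
theorem ev_aPlexEQ (u u' : Fin n) : ev x (aPlexEQ L u u') = decide (pvec L x u = pvec (r := r) L x u') := by
  rw [aPlexEQ, ev_aPpfx, decide_eq_decide]
  simp only [Fin.val_last, Fin.is_lt, forall_true_left]
  exact ⟨fun h => funext h, fun h i => by rw [h]⟩

/-! ### Blocks -/

/-- A counting gate over `W ∧ φ`. -/
theorem maj_W_iff (θ : Fin (n + 1)) (φ : Fin n → Atom K r n) (Pφ : Fin n → Prop) [DecidablePred Pφ]
    (hφ : ∀ w, ev x (φ w) = true ↔ Pφ w) :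
    (GateFn.maj (n + n)).2 (fun i => GateDAG.wire x (Vl K x)
      (cnt n θ (fun w => w1 (n1and [pos (aW L (tf n) w), pos (φ w)])) i)) = true ↔
      (θ : ℕ) ≤ ((finSt L.1 x).W.filter fun w => Pφ w).card := by
  have h := corr_fin (L := L) (x := x) hn
  rw [maj_cnt_iff x (Nat.lt_succ_iff.1 θ.2)]
  have hw : ∀ w, GateDAG.wire x (Vl K x) (w1 (n1and [pos (aW L (tf n) w), pos (φ w)])) = true ↔ (w ∈ (finSt L.1 x).W ∧ Pφ w) := by
    intro w; rw [wire_w1, Vl_n1and x _ (by simp)]; simp [h.W, hφ]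
  simp only [hw]
  rw [show (univ.filter fun w => w ∈ (finSt L.1 x).W ∧ Pφ w) = (finSt L.1 x).W.filter fun w => Pφ w from by ext; simp]

/-- `pstGE u t` computes `t ≤ pstart u`. -/
theorem ev_aPstGE (u : Fin n) (t : Fin (n + 1)) : ev x (aPstGE L u t) = decide ((t : ℕ) ≤ pstart (r := r) L x u) := by
  apply Bool.eq_iff_iff.2
  show Vl K x _ = true ↔ _
  rw [Vl_eq, decide_eq_true_iff]
  show (GateFn.maj (n + n)).2 (fun i => GateDAG.wire x (Vl K x) (Kind.argsM L .pstGE (prm (vec1 u) (s := t)) i)) = true ↔ _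
  simp only [Kind.argsM, prm_s, prm_vs, vec1_apply]
  exact maj_W_iff (L := L) hn t (fun w => aPlexLT L w u) (fun w => toLex (pvec L x w) < toLex (pvec (r := r) L x u)) fun w => by
    rw [ev_aPlexLT, decide_eq_true_iff]

/-- `pbcGE u t` computes `t ≤ pbc u`. -/
theorem ev_aPbcGE (u : Fin n) (t : Fin (n + 1)) : ev x (aPbcGE L u t) = decide ((t : ℕ) ≤ pbc (r := r) L x u) := by
  apply Bool.eq_iff_iff.2
  show Vl K x _ = true ↔ _
  rw [Vl_eq, decide_eq_true_iff]
  show (GateFn.maj (n + n)).2 (fun i => GateDAG.wire x (Vl K x) (Kind.argsM L .pbcGE (prm (vec1 u) (s := t)) i)) = true ↔ _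
  simp only [Kind.argsM, prm_s, prm_vs, vec1_apply]
  exact maj_W_iff (L := L) hn t (fun w => aPlexEQ L w u) (fun w => pvec L x w = pvec (r := r) L x u) fun w => by
    rw [ev_aPlexEQ, decide_eq_true_iff]

/-! ### Addresses -/

/-- `pat p u i o`. -/
theorem ev_aPat (p u i o : Fin n) : ev x (aPat L p u i o) = decide (patP (r := r) L x p u i o) := by
  apply Bool.eq_iff_iff.2
  show Vl K x _ = true ↔ _
  rw [Vl_eq, decide_eq_true_iff]
  show (GateFn.or (n + 1)).2 (fun s => GateDAG.wire x (Vl K x) (Kind.argsM L .pat (prm (vec1 u) (ns := nvec3 p i o)) s)) = true ↔ _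
  simp only [GateFn.or, decide_eq_true_iff, Kind.argsM, prm_vs, prm_ns, vec1_apply, nvec3_0, nvec3_1, nvec3_2, patP]
  refine exists_congr fun s => ?_
  split_ifs with h
  · rw [wire_w2, Vl_n2and x _ (by simp)]
    simp only [List.mem_cons, List.not_mem_nil, or_false, forall_eq_or_imp, forall_eq, Vl_litN1, holds_pos, ev_aPbit hn,
      ev_aPbcGE hn, decide_eq_true_eq, h, true_and]
    rw [Vl_n1and x _ (by simp)]
    simp only [List.mem_cons, List.not_mem_nil, or_false, forall_eq_or_imp, forall_eq, holds_pos, holds_neg, ev_aPstGE hn,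
      decide_eq_true_eq, decide_eq_false_iff_not, not_le]
    constructor
    · rintro ⟨⟨h1, h2⟩, h3, h4⟩; exact ⟨by omega, h3, h4⟩
    · rintro ⟨h1, h3, h4⟩; exact ⟨⟨by omega, by omega⟩, h3, h4⟩
  · simp only [wire_wA, ev_ff, Bool.false_eq_true, false_iff, not_and]
    intro h1 h2 h3; exact absurd ⟨h1, h2, h3⟩ h

/-- `off p u o`: `p` lies in the block of `u` at inner offset `o`. -/
theorem ev_aOff (p u o : Fin n) : ev x (aOff L p u o) = decide (∃ i, patP (r := r) L x p u i o) := by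
  apply Bool.eq_iff_iff.2
  show Vl K x _ = true ↔ _
  rw [Vl_eq, decide_eq_true_iff]
  show (GateFn.or n).2 (fun i => GateDAG.wire x (Vl K x) (Kind.argsM L .off (prm (vec1 u) (ns := nvec2 p o)) i)) = true ↔ _
  simp [GateFn.or, Kind.argsM, ev_aPat hn]

/-- `blkI p u i`: `p` lies in the block of `u` at component slot `i`. -/
theorem ev_aBlkI (p u i : Fin n) : ev x (aBlkI L p u i) = decide (∃ o, patP (r := r) L x p u i o) := by
  apply Bool.eq_iff_iff.2
  show Vl K x _ = true ↔ _
  rw [Vl_eq, decide_eq_true_iff]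
  show (GateFn.or n).2 (fun o => GateDAG.wire x (Vl K x) (Kind.argsM L .blkI (prm (vec1 u) (ns := nvec2 p i)) o)) = true ↔ _
  simp [GateFn.or, Kind.argsM, ev_aPat hn]

end WCan

end Summit.PneNP.PneNP.Theorems

end
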